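import Literature.IUT.HodgeArakelov.ThetaEvaluationSetting

/-!
# [IUTchII] Prop 2.2 (i) as typed: the G11 negative companion (kernel witness of vacuity)

Proof-only companion (abc-iut cell, wave-3 discharge seat abc-iut-L6-d1, RQ7 second-pass audit finding
F4 on p407103, filed per abc-iut-L6-lead's ruling 2026-08-25T20:42:11Z (3-writer split: this file = d1;
`LabelClassesOfCuspsNegative.lean` = abc-iut-L6-t19); no definitions, the audited module is imported
unchanged). Node **IUTchII:Prop2.2(i)**.

S. Mochizuki, *Inter-universal Teichmüller theory II*, kurims manuscript (Dec. 2020), Prop. 2.2 (i) p. 66: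
"The collection of data `(Π_{v•} ⊆ Π_{v▶} ⊆ Π_v, ι)`, regarded up to `Π_v`-conjugacy, may be reconstructed
via a functorial group-theoretic algorithm from the topological group `Π_v`." In the tree this is the
predicate `Prop22_i T D := Nonempty (SubgraphDecomposition S T D)`. WHAT IS SHOWN HERE: that predicate holds
for EVERY input `(T, D)` — witness `Π_{v•} = Π_{v▶} = {1}`, `ι = id`, reference decomposition groups
`refTri = refBullet = {1}` — because the structure's reference groups `refTri`, `refBullet` are free fields
(so `corresponds` is satisfiable by `⊥ ↦ ⊥`) and `iota` is constrained only to stabilise the chosen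
subgroups (which `id` does). Hence, AS TYPED, `Prop22_i` carries none of the printed content (the printed
decomposition groups are those of the subgraphs `Γ•_X ⊆ Γ▶_X` of [IUTchI] Cor. 2.3 (iii), non-trivial, and
`ι` is the inversion automorphism of Rmk. 1.4.1 (ii) / 2.1.1 (ii), of order 2 on cusp labels). This is a
statement about the TYPING, recorded so that the repaired decl (`Prop22_i'`, owner abc-iut-L6-t1: reference
groups moved into `BadPlaceSetting` beside `refY`/`refYdd`, `ι` tied to the pointed inversion) is the one of
record; it asserts nothing about the mathematics of [IUTchII] and takes no side on [IUTchIII] Cor. 3.12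
(claim key `Mochizuki2012`, status DISPUTED, D-0012).
-/

namespace Literature.IUT.HodgeArakelov

universe u

variable {S : BadPlaceSetting.{u}} {P : TopGroup.{u}}

/-- **IUTchII:Prop2.2(i)** AS TYPED (`Prop22_i`, p407103) is VACUOUS: for every Prop. 2.1 / Prop. 1.4 input
`(T, D)` there is a `SubgraphDecomposition` with `Π_{v•} = Π_{v▶} = ⊥`, `ι = id` and trivial reference
groups, so `Prop22_i T D` holds unconditionally (RQ7 finding F4, kernel witness; the printed content —
kurims p. 66, decomposition groups of `Γ•_X ⊆ Γ▶_X` and the inversion `ι_Ÿ` — is not captured).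
[claim: Mochizuki2012, status: disputed] -/
theorem exists_subgraphDecomposition_trivial (T : TemperedCoverings S P)
    (D : EtaleThetaData S.toThetaSetting P) :
    ∃ Dec : SubgraphDecomposition S T D,
      Dec.Pbullet = ⊥ ∧ Dec.Ptri = ⊥ ∧ Dec.iota = ContinuousMulEquiv.refl P ∧
        Dec.refTri = ⊥ ∧ Dec.refBullet = ⊥ :=
  ⟨{ Pbullet := ⊥
     Ptri := ⊥
     bullet_le_tri := le_rfl
     tri_le_YL := bot_le
     iota := ContinuousMulEquiv.refl P
     iota_bullet := Subgroup.map_bot _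
     iota_tri := Subgroup.map_bot _
     iota_Ydd := by
       change D.PiYdd.map (MonoidHom.id P) = D.PiYdd
       exact Subgroup.map_id _
     refTri := ⊥
     refBullet := ⊥
     corresponds := ⟨T.isoRef.some, 1, by rw [Subgroup.map_bot, Subgroup.map_bot],
       by rw [Subgroup.map_bot, Subgroup.map_bot]⟩ }, rfl, rfl, rfl, rfl, rfl⟩

/-- **IUTchII:Prop2.2(i)** AS TYPED holds for EVERY input: `Prop22_i T D` (:= `Nonempty
(SubgraphDecomposition S T D)`) is a theorem with no hypotheses — the G11 negative companion of p407103
(RQ7 F4; abc-iut-L6-t19's independent witness `AuditL6t19.Prop22_i_trivial` is the same statement).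
[claim: Mochizuki2012, status: disputed] -/
theorem prop22_i_trivial (T : TemperedCoverings S P) (D : EtaleThetaData S.toThetaSetting P) :
    Prop22_i T D :=
  let ⟨Dec, _⟩ := exists_subgraphDecomposition_trivial T D
  ⟨Dec⟩

end Literature.IUT.HodgeArakelov
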